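import Summits.KontsevichZagierPeriods.KontsevichZagierPeriods.Theorems.SoloInformedAlgCone
import Mathlib.Algebra.MvPolynomial.PDeriv
import Mathlib.Data.Nat.Factorial.BigOperators
import HarnessLib

/-!
# The DEN-calculus over `K`: partial derivatives of blow-up charts and child germs

Solo programme `solo-KontsevichZagierPeriods-informed`, session s107, step (x-n) of the general
two-dimensional algorithm: the algebra of `∂₁ = ∂/∂x₁` needed for the termination measure
(the maximal-contact polynomial `∂₁^{m-1} F`).

* the chain rule for `∂ᵢ ∘ bind₁` on `K[x₀, x₁]` and its instances for the coordinate rescalings;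
* `lowSubst F = x₀^m · F_low` and `∂₁ (F_low) = (∂₁ F)_low` (with `m - 1` in place of `m`);
* `∂₁^j (child_F(t, κ, λ)) = λ^j · child_{∂₁^j F}(t, κ, λ)`;
* the coefficients of `∂₁^j F`; in particular the constant and linear coefficients of the
  maximal-contact polynomial `∂₁^k F` of an `F` of multiplicity `k + 1` with cone `c (X − θ)^{k+1}`:
  `0`, `-(k+1)! c θ` (in `x₀`) and `(k+1)! c` (in `x₁`).

References: J. Kollár, *Lectures on Resolution of Singularities* (2007), §1.10 (maximal contact).
-/

noncomputable section

open scoped BigOperators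
open Polynomial

namespace Summit.KontsevichZagierPeriods.KontsevichZagierPeriods.Theorems

variable {K : Type*} [Field K]

/-! ### The chain rule -/

/-- **Chain rule** for a partial derivative of a substitution on `K[x₀, x₁]`. [this work] -/
theorem soloInformed_pderiv_bind₁ (f : Fin 2 → MvPolynomial (Fin 2) K) (i : Fin 2)
    (P : MvPolynomial (Fin 2) K) :
    MvPolynomial.pderiv i (MvPolynomial.bind₁ f P) =
      MvPolynomial.bind₁ f (MvPolynomial.pderiv 0 P) * MvPolynomial.pderiv i (f 0) +
        MvPolynomial.bind₁ f (MvPolynomial.pderiv 1 P) * MvPolynomial.pderiv i (f 1) := by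
  induction P using MvPolynomial.induction_on with
  | C a => simp
  | add p q hp hq => simp only [map_add, hp, hq]; ring
  | mul_X p n ih =>
    rw [map_mul, MvPolynomial.bind₁_X_right, MvPolynomial.pderiv_mul, ih]
    fin_cases n
    · simp only [MvPolynomial.pderiv_mul, MvPolynomial.pderiv_X_self,
        MvPolynomial.pderiv_X_of_ne (zero_ne_one : (0 : Fin 2) ≠ 1), map_add, map_mul, map_one,
        map_zero, MvPolynomial.bind₁_X_right, Fin.zero_eta]
      ring
    · simp only [MvPolynomial.pderiv_mul, MvPolynomial.pderiv_X_self,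
        MvPolynomial.pderiv_X_of_ne (one_ne_zero : (1 : Fin 2) ≠ 0), map_add, map_mul, map_one,
        map_zero, MvPolynomial.bind₁_X_right, Fin.mk_one]
      ring

/-- `∂₁` commutes with a rescaling of `x₀`. [this work] -/
theorem soloInformed_pderiv_one_scaleSubstK_zero (a b : K) (P : MvPolynomial (Fin 2) K) :
    MvPolynomial.pderiv 1 (soloInformedScaleSubstK 0 a b P) =
      soloInformedScaleSubstK 0 a b (MvPolynomial.pderiv 1 P) := by
  unfold soloInformedScaleSubstK
  rw [soloInformed_pderiv_bind₁]
  simp [MvPolynomial.pderiv_X_of_ne (zero_ne_one : (0 : Fin 2) ≠ 1)]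

/-- `∂₁` of a rescaling of `x₁` picks up the scale factor. [this work] -/
theorem soloInformed_pderiv_one_scaleSubstK_one (a b : K) (P : MvPolynomial (Fin 2) K) :
    MvPolynomial.pderiv 1 (soloInformedScaleSubstK 1 a b P) =
      MvPolynomial.C b * soloInformedScaleSubstK 1 a b (MvPolynomial.pderiv 1 P) := by
  unfold soloInformedScaleSubstK
  rw [soloInformed_pderiv_bind₁]
  simp [MvPolynomial.pderiv_X_of_ne (zero_ne_one : (0 : Fin 2) ≠ 1), mul_comm]

/-! ### The blow-up chart and `∂₁` -/

/-- A monomial of `K[x₀, x₁]` as a product of powers. [this work] -/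
theorem soloInformed_monomialK_eq (a : Fin 2 →₀ ℕ) (c : K) :
    MvPolynomial.monomial a c =
      MvPolynomial.C c * (MvPolynomial.X 0 ^ a 0 * MvPolynomial.X 1 ^ a 1) := by
  rw [MvPolynomial.monomial_eq, Finsupp.prod_fintype _ _ (fun i => by simp), Fin.prod_univ_two]

/-- **The lower-chart substitution is `x₀^m` times the blow-up chart.** [this work] -/
theorem soloInformed_lowSubstK_eq_X_pow_mul_blowLowK (P : MvPolynomial (Fin 2) K) {m : ℕ}
    (hm : ∀ a ∈ P.support, m ≤ a 0 + a 1) :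
    soloInformedLowSubstK P = MvPolynomial.X 0 ^ m * soloInformedBlowLowK P m := by
  conv_lhs => rw [P.as_sum, map_sum]
  rw [soloInformed_blowLowK_eq_sum, Finset.mul_sum]
  refine Finset.sum_congr rfl fun a ha => ?_
  rw [soloInformed_monomialK_eq, soloInformed_monomialK_eq,
    (soloInformed_single_add_single_apply _ _).1, (soloInformed_single_add_single_apply _ _).2]
  unfold soloInformedLowSubstK
  simp only [map_mul, map_pow, MvPolynomial.bind₁_C_right, MvPolynomial.bind₁_X_right,
    if_true, if_neg (one_ne_zero : (1 : Fin 2) ≠ 0)]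
  have hd : a 0 + a 1 = m + (a 0 + a 1 - m) := by have := hm a ha; omega
  have key : (MvPolynomial.X 0 ^ (a 0 + a 1) : MvPolynomial (Fin 2) K) =
      MvPolynomial.X 0 ^ m * MvPolynomial.X 0 ^ (a 0 + a 1 - m) := by rw [← pow_add, ← hd]
  linear_combination (MvPolynomial.C (MvPolynomial.coeff a P) * MvPolynomial.X 1 ^ a 1) * key

/-- All monomials of `∂₁ P` have degree `≥ m - 1` if those of `P` have degree `≥ m`. [this work] -/
theorem soloInformed_le_deg_pderiv {P : MvPolynomial (Fin 2) K} {m : ℕ}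
    (hm : ∀ a ∈ P.support, m ≤ a 0 + a 1) :
    ∀ b ∈ (MvPolynomial.pderiv 1 P).support, m - 1 ≤ b 0 + b 1 := by
  intro b hb
  rw [MvPolynomial.mem_support_iff, MvPolynomial.coeff_pderiv] at hb
  have h := hm _ (MvPolynomial.mem_support_iff.2 (left_ne_zero_of_mul hb))
  simp only [Finsupp.coe_add, Pi.add_apply, Finsupp.single_eq_same,
    Finsupp.single_eq_of_ne (zero_ne_one : (0 : Fin 2) ≠ 1), add_zero] at h
  omega

/-- All monomials of `∂₁^j P` have degree `≥ m - j` if those of `P` have degree `≥ m`. [this work] -/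
theorem soloInformed_le_deg_iterate_pderiv {P : MvPolynomial (Fin 2) K} {m : ℕ}
    (hm : ∀ a ∈ P.support, m ≤ a 0 + a 1) (j : ℕ) :
    ∀ b ∈ ((MvPolynomial.pderiv 1)^[j] P).support, m - j ≤ b 0 + b 1 := by
  induction j with
  | zero => simpa using hm
  | succ j ih =>
    rw [Function.iterate_succ_apply', show m - (j + 1) = m - j - 1 by omega]
    exact soloInformed_le_deg_pderiv ih

/-- **`∂₁` commutes with the blow-up chart**: `∂₁ (F_low,m) = (∂₁ F)_low,m-1`. [this work] -/
theorem soloInformed_pderiv_blowLowK (P : MvPolynomial (Fin 2) K) {m : ℕ}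
    (hm : ∀ a ∈ P.support, m ≤ a 0 + a 1) (h1 : 1 ≤ m) :
    MvPolynomial.pderiv 1 (soloInformedBlowLowK P m) =
      soloInformedBlowLowK (MvPolynomial.pderiv 1 P) (m - 1) := by
  have hP := soloInformed_lowSubstK_eq_X_pow_mul_blowLowK P hm
  have hP' := soloInformed_lowSubstK_eq_X_pow_mul_blowLowK _ (soloInformed_le_deg_pderiv hm)
  have hchain : MvPolynomial.pderiv 1 (soloInformedLowSubstK P) =
      soloInformedLowSubstK (MvPolynomial.pderiv 1 P) * MvPolynomial.X 0 := by
    unfold soloInformedLowSubstK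
    rw [soloInformed_pderiv_bind₁]
    simp [MvPolynomial.pderiv_X_of_ne (zero_ne_one : (0 : Fin 2) ≠ 1)]
  rw [hP, hP', MvPolynomial.pderiv_mul] at hchain
  have hX : MvPolynomial.pderiv 1 (MvPolynomial.X (R := K) (0 : Fin 2) ^ m) = 0 := by
    rw [MvPolynomial.pderiv_pow, MvPolynomial.pderiv_X_of_ne (zero_ne_one : (0 : Fin 2) ≠ 1),
      mul_zero]
  rw [hX, zero_mul, zero_add, mul_assoc, mul_comm (soloInformedBlowLowK _ (m - 1)), ← mul_assoc,
    ← pow_succ, show m - 1 + 1 = m by omega] at hchain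
  exact mul_left_cancel₀ (pow_ne_zero _ (MvPolynomial.X_ne_zero _)) hchain

/-- **`∂₁^j` of a child germ**: `∂₁^j child_F(t, κ, λ) = λ^j · child_{∂₁^j F}(t, κ, λ)`
(multiplicity parameter `m - j`). [this work] -/
theorem soloInformed_iterate_pderiv_childK (F : MvPolynomial (Fin 2) K) {m : ℕ}
    (hm : ∀ a ∈ F.support, m ≤ a 0 + a 1) (t κ lam : K) {j : ℕ} (hj : j ≤ m) :
    (MvPolynomial.pderiv 1)^[j] (soloInformedChildK F m t κ lam) =
      MvPolynomial.C (lam ^ j) *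
        soloInformedChildK ((MvPolynomial.pderiv 1)^[j] F) (m - j) t κ lam := by
  induction j with
  | zero => simp
  | succ j ih =>
    rw [Function.iterate_succ_apply', ih (by omega), MvPolynomial.pderiv_C_mul]
    conv_lhs => rw [soloInformedChildK, soloInformed_pderiv_one_scaleSubstK_zero,
      soloInformed_pderiv_one_scaleSubstK_one,
      soloInformed_pderiv_blowLowK _ (soloInformed_le_deg_iterate_pderiv hm j) (by omega),
      map_mul, MvPolynomial.algHom_C]
    rw [Function.iterate_succ_apply', show m - (j + 1) = m - j - 1 by omega, pow_succ, map_mul,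
      soloInformedChildK, MvPolynomial.algebraMap_eq]
    ring

/-! ### Coefficients of iterated derivatives -/

/-- Coefficients of `∂₁^j P`. [this work] -/
theorem soloInformed_coeff_iterate_pderiv (P : MvPolynomial (Fin 2) K) (j : ℕ) (b : Fin 2 →₀ ℕ) :
    MvPolynomial.coeff b ((MvPolynomial.pderiv 1)^[j] P) =
      (∏ i ∈ Finset.range j, (b 1 + 1 + i : ℕ) : ℕ) *
        MvPolynomial.coeff (b + Finsupp.single 1 j) P := by
  induction j generalizing b with
  | zero => simp
  | succ j ih =>
    rw [Function.iterate_succ_apply', MvPolynomial.coeff_pderiv, ih, Finset.prod_range_succ',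
      add_assoc, ← Finsupp.single_add, Nat.cast_mul]
    simp only [Finsupp.coe_add, Pi.add_apply, Finsupp.single_eq_same, add_zero, Nat.cast_add,
      Nat.cast_one]
    have : ∀ i : ℕ, (b 1 + 1 + 1 + i : ℕ) = b 1 + 1 + (i + 1) := fun i => by omega
    simp only [this, add_comm 1 j]
    ring

/-- The constant coefficient of `∂₁^k P` vanishes if all monomials of `P` have degree `≥ k + 1`.
[this work] -/
theorem soloInformed_coeff_zero_iterate_pderiv {P : MvPolynomial (Fin 2) K} {k : ℕ}
    (hm : ∀ a ∈ P.support, k + 1 ≤ a 0 + a 1) :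
    MvPolynomial.coeff 0 ((MvPolynomial.pderiv 1)^[k] P) = 0 :=
  soloInformed_coeff_zero_eq_zero_of_le (k := 0)
    (by simpa using soloInformed_le_deg_iterate_pderiv hm k)

/-- `∏_{i<k} (2 + i) = (k + 1)!`. [this work] -/
theorem soloInformed_prod_range_two_add (k : ℕ) :
    ∏ i ∈ Finset.range k, (1 + 1 + i : ℕ) = (k + 1).factorial := by
  induction k with
  | zero => simp
  | succ k ih => rw [Finset.prod_range_succ, ih, Nat.factorial_succ (k + 1)]; ring

/-- The `x₁`-coefficient of `∂₁^k P` is `(k+1)!` times the `x₁^{k+1}`-coefficient of `P`.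
[this work] -/
theorem soloInformed_coeff_single_one_iterate_pderiv (P : MvPolynomial (Fin 2) K) (k : ℕ) :
    MvPolynomial.coeff (Finsupp.single 1 1) ((MvPolynomial.pderiv 1)^[k] P) =
      ((k + 1).factorial : ℕ) * MvPolynomial.coeff (Finsupp.single 1 (k + 1)) P := by
  rw [soloInformed_coeff_iterate_pderiv, Finsupp.single_eq_same, soloInformed_prod_range_two_add,
    ← Finsupp.single_add, add_comm]

/-- The `x₀`-coefficient of `∂₁^k P` is `k!` times the `x₀x₁^k`-coefficient of `P`. [this work] -/
theorem soloInformed_coeff_single_zero_iterate_pderiv (P : MvPolynomial (Fin 2) K) (k : ℕ) :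
    MvPolynomial.coeff (Finsupp.single 0 1) ((MvPolynomial.pderiv 1)^[k] P) =
      (k.factorial : ℕ) * MvPolynomial.coeff (Finsupp.single 0 1 + Finsupp.single 1 k) P := by
  rw [soloInformed_coeff_iterate_pderiv]
  have h0 : (Finsupp.single (0 : Fin 2) 1 : Fin 2 →₀ ℕ) 1 = 0 := by simp
  simp_rw [h0, zero_add, add_comm 1]
  rw [Finset.prod_range_add_one_eq_factorial]

/-! ### The maximal-contact polynomial of a pure cone -/

/-- The `x₁`-coefficient of `∂₁^k F` for `F` with cone `c (X − θ)^{k+1}`: `(k+1)! c`. [this work] -/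
theorem soloInformed_coeff_single_one_maxContact_of_pow {F : MvPolynomial (Fin 2) K} {k : ℕ}
    (hm : ∀ a ∈ F.support, k + 1 ≤ a 0 + a 1) {c θ : K}
    (h : soloInformedConePolyK F (k + 1) = C c * (X - C θ) ^ (k + 1)) :
    MvPolynomial.coeff (Finsupp.single 1 1) ((MvPolynomial.pderiv 1)^[k] F) =
      ((k + 1).factorial : ℕ) * c := by
  rw [soloInformed_coeff_single_one_iterate_pderiv]
  have hc := soloInformed_coeff_conePolyK F hm (k + 1)
  rw [h, if_pos le_rfl, Nat.sub_self, Finsupp.single_zero, zero_add, Polynomial.coeff_C_mul,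
    sub_eq_add_neg, ← map_neg C, Polynomial.coeff_X_add_C_pow, Nat.sub_self, pow_zero,
    Nat.choose_self, Nat.cast_one, mul_one, mul_one] at hc
  rw [← hc]

/-- The `x₀`-coefficient of `∂₁^k F` for `F` with cone `c (X − θ)^{k+1}`: `-(k+1)! c θ`.
[this work] -/
theorem soloInformed_coeff_single_zero_maxContact_of_pow {F : MvPolynomial (Fin 2) K} {k : ℕ}
    (hm : ∀ a ∈ F.support, k + 1 ≤ a 0 + a 1) {c θ : K}
    (h : soloInformedConePolyK F (k + 1) = C c * (X - C θ) ^ (k + 1)) :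
    MvPolynomial.coeff (Finsupp.single 0 1) ((MvPolynomial.pderiv 1)^[k] F) =
      -(((k + 1).factorial : ℕ) * c * θ) := by
  rw [soloInformed_coeff_single_zero_iterate_pderiv]
  have hc := soloInformed_coeff_conePolyK F hm k
  rw [h, if_pos (Nat.le_succ k), Nat.add_sub_cancel_left, Polynomial.coeff_C_mul, sub_eq_add_neg,
    ← map_neg C, Polynomial.coeff_X_add_C_pow, Nat.add_sub_cancel_left, pow_one,
    Nat.choose_succ_self_right] at hc
  rw [← hc, Nat.factorial_succ, Nat.cast_mul]
  push_cast
  ring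

/-! ### Multiplicity -/

/-- The multiplicity of a polynomial whose monomials have degree `≥ n`, one of them exactly `n`.
[this work] -/
theorem soloInformed_multK_eq_of_le_deg {F : MvPolynomial (Fin 2) K} {n : ℕ}
    (hm : ∀ a ∈ F.support, n ≤ a 0 + a 1) {a : Fin 2 →₀ ℕ} (ha : a ∈ F.support)
    (hdeg : a 0 + a 1 = n) : soloInformedMultK F = n :=
  le_antisymm (hdeg ▸ soloInformed_multK_le ha) (by
    unfold soloInformedMultK
    rw [dif_pos ⟨a, ha⟩]
    exact Finset.le_inf' _ _ hm)

/-- Monomials have degree at least the multiplicity (restated with `k + 1`). [this work] -/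
theorem soloInformed_le_deg_of_multK_eq {F : MvPolynomial (Fin 2) K} {n : ℕ}
    (h : soloInformedMultK F = n) : ∀ a ∈ F.support, n ≤ a 0 + a 1 :=
  fun _ ha => h ▸ soloInformed_multK_le ha

end Summit.KontsevichZagierPeriods.KontsevichZagierPeriods.Theorems
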